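import Literature.Topology.FourManifolds.RegularLevelSet
import Literature.Topology.FourManifolds.ImmersionCriterion
import Literature.Topology.FourManifolds.ImmersionOrientation
import Literature.Geometry.Manifold.OpenSubmanifoldMFDeriv
import Mathlib.Analysis.Normed.Ring.Units
import Mathlib.Topology.Algebra.Module.FiniteDimension
import HarnessLib

/-!
# The regular value theorem in arbitrary codimension: `G⁻¹(y)` is a submanifold

Topic `Literature/Topology/FourManifolds`; general differential topology infrastructure (the
transversality step of the Pontryagin–Thom construction, Kervaire–Milnor, *Groups of homotopy
spheres I*, Ann. of Math. 77 (1963), proof of Lemma 4.2, p. 510: the bounding manifold `W` is the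
preimage of a regular value under a smooth null-homotopy `Sⁿ⁺ᵏ × [0, 1] → Sᵏ`; Kosinski,
*Differential Manifolds* (1993), IV (1.4)/(5.5)).  The tree has the real-valued case
(`RegularLevelSet.lean`: `Literature.Topology.FourManifolds.IsRegularLevel`,
`Literature.Topology.FourManifolds.RegularLevel` — Hirsch, *Differential Topology* (1976), Ch. 1
§3, Thm. 3.2 for `f : M → ℝ`); this file derives the `ℝᵏ`-valued case by iterating it, one
coordinate at a time:

**Hirsch, Ch. 1 §3, Thm. 3.2** (*"If `y ∈ f(M)` is a regular value, then `f⁻¹(y)` is a `Cʳ`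
submanifold of `M`"*, of dimension `dim M - dim N`, `T_x f⁻¹(y) = Ker T_x f`), for `N = ℝᵏ`:

* `Literature.Topology.FourManifolds.exists_regularPreimage` — if `G : V → ℝᵏ` is `C^∞` on a
  `C^∞` manifold `V` without boundary (Hausdorff, second countable, modelled on `ℝⁿ`, `n = m + k`)
  and `dG_v` is onto at **every** point of `V` (restrict first to the open set of regular points),
  then for every `y` there are a `C^∞` `m`-manifold `Z` without boundary and a `C^∞` embedding
  `e : Z → V` (`Manifold.IsSmoothEmbedding`) with `range e = G⁻¹(y)` and
  `range (de_z) = ker (dG_{e z})` (stated pointwise: `dG_{e z} ξ = 0 ↔ ξ ∈ range de_z`).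
  Proof by induction on `k`: split `G = (G', G_k)` along the tree's `snocEquiv`; the level of `G_k`
  is the tree's manifold `RegularLevel`, on which `G'` again has onto differential
  (`T(level) = ker dG_k` by a dimension count); composite embeddings are embeddings by the tree's
  immersion criterion `isImmersion_of_injective_mfderiv` (`ImmersionCriterion.lean`; Mathlib's
  `IsSmoothEmbedding.comp` is still a `proof_wanted`).
* `Literature.Topology.FourManifolds.isOpen_inter_setOf_surjective` — surjectivity of a
  continuous family of linear maps between finite-dimensional spaces is an open condition.
* `Literature.Topology.FourManifolds.exists_regularPreimage_of_contDiffOn` — **the Euclidean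
  form used by the Pontryagin–Thom argument**: for `G : ℝᴺ → ℝᵏ` of class `C^∞` on an open `U`,
  `N = m + k`, and `y` a regular value of `G|U`, the set `U ∩ G⁻¹(y)` is the image of a `C^∞`
  embedding `e : Z → ℝᴺ` of an `m`-manifold without boundary,
  `fderiv ℝ G (e z) ξ = 0 ↔ ξ ∈ range de_z`.

Everything here is proved; no definitions, no named facts.

## References

* M. W. Hirsch, *Differential Topology*, GTM 33, Springer (1976), Ch. 1 §3, Thms. 3.1–3.2; §4,
  Thm. 4.1. [HirschDT1976]
* M. Kervaire, J. Milnor, *Groups of homotopy spheres I*, Ann. of Math. (2) 77 (1963), 504–537,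
  proof of Lemma 4.2 (p. 510). doi:10.2307/1970128 [KervaireMilnorAnnals1963]
* A. Kosinski, *Differential Manifolds*, Academic Press (1993), IV (1.4), IX (5.5). [Kosinski1993]
-/

open scoped Manifold ContDiff Topology
open Set Function Module

noncomputable section

universe u

namespace Literature.Topology.FourManifolds

/-! ### Linear algebra -/

section LinearAlgebra

/-- **`range A = ker ℓ` by a dimension count.** If `A : ℝⁿ → ℝⁿ⁺¹` is an injective linear map,
`ℓ` a nonzero linear form on `ℝⁿ⁺¹` with `ℓ ∘ A = 0`, then every `ξ` with `ℓ ξ = 0` lies in the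
range of `A` (both `range A` and `ker ℓ` have dimension `n`).  This is the tangent space of a
regular level: `T(f⁻¹(a)) = ker df` (Hirsch, *Differential Topology* (1976), Ch. 1 §3–§4).
[folklore] -/
theorem exists_apply_eq_of_linearForm_apply_eq_zero {n : ℕ}
    {A : EuclideanSpace ℝ (Fin n) →L[ℝ] EuclideanSpace ℝ (Fin (n + 1))}
    {ℓ : EuclideanSpace ℝ (Fin (n + 1)) →L[ℝ] ℝ} (hA : Injective A) (hℓ : ℓ ≠ 0)
    (hcomp : ∀ u, ℓ (A u) = 0) {ξ : EuclideanSpace ℝ (Fin (n + 1))} (hξ : ℓ ξ = 0) :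
    ∃ u, A u = ξ := by
  have hle : LinearMap.range (A : EuclideanSpace ℝ (Fin n) →ₗ[ℝ] EuclideanSpace ℝ (Fin (n + 1))) ≤
      LinearMap.ker (ℓ : EuclideanSpace ℝ (Fin (n + 1)) →ₗ[ℝ] ℝ) := by
    rintro _ ⟨u, rfl⟩
    exact hcomp u
  have h1 : finrank ℝ
      (LinearMap.range (A : EuclideanSpace ℝ (Fin n) →ₗ[ℝ] EuclideanSpace ℝ (Fin (n + 1)))) =
        n := by
    rw [LinearMap.finrank_range_of_inj
        (f := (A : EuclideanSpace ℝ (Fin n) →ₗ[ℝ] EuclideanSpace ℝ (Fin (n + 1)))) hA,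
      finrank_euclideanSpace_fin]
  have h2 : finrank ℝ (LinearMap.ker (ℓ : EuclideanSpace ℝ (Fin (n + 1)) →ₗ[ℝ] ℝ)) = n := by
    have hsurj : LinearMap.range (ℓ : EuclideanSpace ℝ (Fin (n + 1)) →ₗ[ℝ] ℝ) = ⊤ := by
      obtain ⟨v, hv⟩ : ∃ v, ℓ v ≠ 0 := by
        by_contra h
        push Not at h
        exact hℓ (ContinuousLinearMap.ext h)
      refine LinearMap.range_eq_top.2 fun t => ⟨(t / ℓ v) • v, ?_⟩
      simp only [ContinuousLinearMap.coe_coe, map_smul, smul_eq_mul]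
      exact div_mul_cancel₀ t hv
    have hrank :=
      LinearMap.finrank_range_add_finrank_ker (ℓ : EuclideanSpace ℝ (Fin (n + 1)) →ₗ[ℝ] ℝ)
    rw [hsurj, finrank_top, Module.finrank_self, finrank_euclideanSpace_fin] at hrank
    omega
  have heq := Submodule.eq_of_le_of_finrank_eq hle (by rw [h1, h2])
  have hmem : ξ ∈ LinearMap.ker (ℓ : EuclideanSpace ℝ (Fin (n + 1)) →ₗ[ℝ] ℝ) := hξ
  rw [← heq] at hmem
  obtain ⟨u, hu⟩ := hmem
  exact ⟨u, hu⟩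

/-- **Surjectivity of a continuous family of linear maps between finite-dimensional spaces is an
open condition**: if `T : X → (E →L F)` is continuous on an open set `U`, then
`{p ∈ U | T p onto}` is open.  A right inverse `B` of `T p₀` satisfies `T p ∘ B ∈ End(F)ˣ` for
`p` near `p₀` (the units of the Banach algebra `End(F)` are open), so `T p` is onto. [folklore] -/
theorem isOpen_inter_setOf_surjective {X E F : Type*} [TopologicalSpace X]
    [NormedAddCommGroup E] [NormedSpace ℝ E] [FiniteDimensional ℝ E]
    [NormedAddCommGroup F] [NormedSpace ℝ F] [FiniteDimensional ℝ F]
    {T : X → E →L[ℝ] F} {U : Set X} (hU : IsOpen U) (hT : ContinuousOn T U) :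
    IsOpen {p ∈ U | Surjective (T p)} := by
  haveI : CompleteSpace F := FiniteDimensional.complete ℝ F
  rw [isOpen_iff_mem_nhds]
  rintro p₀ ⟨hp₀U, hp₀⟩
  obtain ⟨B, hB⟩ := (T p₀).exists_rightInverse_of_surjective
    (LinearMap.range_eq_top.2 hp₀)
  have hunit : IsUnit ((T p₀).comp B) := by
    rw [hB]
    exact isUnit_one
  have hcont : ContinuousOn (fun p => (T p).comp B) U := hT.clm_comp continuousOn_const
  have hmem : ∀ᶠ p in 𝓝 p₀, p ∈ U ∧ IsUnit ((T p).comp B) := by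
    have h1 : ∀ᶠ p in 𝓝 p₀, p ∈ U := hU.mem_nhds hp₀U
    have h2 : ContinuousAt (fun p => (T p).comp B) p₀ :=
      (hcont p₀ hp₀U).continuousAt (hU.mem_nhds hp₀U)
    exact h1.and (h2.preimage_mem_nhds (Units.isOpen.mem_nhds hunit))
  refine Filter.mem_of_superset hmem ?_
  rintro p ⟨hpU, hu⟩
  refine ⟨hpU, fun w => ?_⟩
  obtain ⟨C, hC⟩ := hu.exists_right_inv
  rw [ContinuousLinearMap.mul_def, ContinuousLinearMap.one_def] at hC
  exact ⟨B (C w), DFunLike.congr_fun hC w⟩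

end LinearAlgebra

/-! ### The regular value theorem for `ℝᵏ`-valued maps -/

section Main

/-- **The regular value theorem in codimension `k` (inductive form).**  Let `V` be a `C^∞`
manifold without boundary modelled on `ℝⁿ`, `n = m + k` (Hausdorff, second countable), and
`G : V → ℝᵏ` a `C^∞` map whose differential is surjective at every point.  Then for every
`y ∈ ℝᵏ` there are a `C^∞` manifold `Z` without boundary modelled on `ℝᵐ` (Hausdorff, second
countable) and a `C^∞` embedding `e : Z → V` with image the level `G⁻¹(y)` and with
`range (de_z) = ker (dG_{e z})` at every point — Hirsch, *Differential Topology* (1976), Ch. 1 §3,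
Thm. 3.2 (*"if `y ∈ f(M)` is a regular value, then `f⁻¹(y)` is a `Cʳ` submanifold of `M`"*) with
§4 (the tangent space of the level is the kernel of the differential), obtained by `k`-fold
iteration of the real-valued case `Literature.Topology.FourManifolds.RegularLevel`: split
`G = (G', G_k)` along `snocEquiv`; the level of `G_k` is a manifold on which `G'` still has
everywhere surjective differential, because the tangent space of the level is `ker dG_k`
(`exists_apply_eq_of_linearForm_apply_eq_zero`).
[cite: HirschDT1976, Ch. 1 §3 Thm. 3.2 and §4 Thm. 4.1] -/
theorem exists_regularPreimage :
    ∀ (k m n : ℕ), n = m + k → ∀ (V : Type u) [TopologicalSpace V] [T2Space V]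
      [SecondCountableTopology V] [ChartedSpace (EuclideanSpace ℝ (Fin n)) V] [IsManifold (𝓡 n) ∞ V]
      (G : V → EuclideanSpace ℝ (Fin k)), ContMDiff (𝓡 n) (𝓡 k) ∞ G →
      (∀ v, Surjective (mfderiv (𝓡 n) (𝓡 k) G v)) → ∀ y : EuclideanSpace ℝ (Fin k),
      ∃ (Z : Type u) (_ : TopologicalSpace Z) (_ : T2Space Z) (_ : SecondCountableTopology Z)
        (_ : ChartedSpace (EuclideanSpace ℝ (Fin m)) Z) (_ : IsManifold (𝓡 m) ∞ Z) (e : Z → V),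
        Manifold.IsSmoothEmbedding (𝓡 m) (𝓡 n) ∞ e ∧ range e = G ⁻¹' {y} ∧
        ∀ (z : Z) (ξ : EuclideanSpace ℝ (Fin n)), mfderiv (𝓡 n) (𝓡 k) G (e z) ξ = 0 ↔
          ∃ u : EuclideanSpace ℝ (Fin m), mfderiv (𝓡 m) (𝓡 n) e z u = ξ := by
  intro k
  induction k with
  | zero =>
    intro m n hn V _ _ _ _ _ G hG hsurj y
    obtain rfl : n = m := by omega
    refine ⟨V, inferInstance, inferInstance, inferInstance, inferInstance, inferInstance, id,
      Manifold.IsSmoothEmbedding.id, ?_, fun z ξ => ⟨fun _ => ⟨ξ, ?_⟩, fun _ => ?_⟩⟩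
    · ext v
      simp only [range_id, mem_univ, mem_preimage, mem_singleton_iff, true_iff]
      exact Subsingleton.elim (α := EuclideanSpace ℝ (Fin 0)) _ _
    · rw [mfderiv_id]
      rfl
    · exact Subsingleton.elim (α := EuclideanSpace ℝ (Fin 0)) _ _
  | succ j ih =>
    intro m n hn V _ _ _ _ _ G hG hsurj y
    obtain rfl : n = m + j + 1 := by omega
    have h1 : (1 : ℕ∞ω) ≤ ∞ := by exact_mod_cast le_top
    have h0 : (∞ : ℕ∞ω) ≠ 0 := by simp
    -- split off the last coordinate of the target
    set L : (EuclideanSpace ℝ (Fin j) × ℝ) ≃L[ℝ] EuclideanSpace ℝ (Fin (j + 1)) := snocEquiv j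
      with hL
    set gl : EuclideanSpace ℝ (Fin (j + 1)) →L[ℝ] ℝ :=
      (ContinuousLinearMap.snd ℝ (EuclideanSpace ℝ (Fin j)) ℝ).comp
        (L.symm : EuclideanSpace ℝ (Fin (j + 1)) →L[ℝ] (EuclideanSpace ℝ (Fin j) × ℝ)) with hgl
    set gi : EuclideanSpace ℝ (Fin (j + 1)) →L[ℝ] EuclideanSpace ℝ (Fin j) :=
      (ContinuousLinearMap.fst ℝ (EuclideanSpace ℝ (Fin j)) ℝ).comp
        (L.symm : EuclideanSpace ℝ (Fin (j + 1)) →L[ℝ] (EuclideanSpace ℝ (Fin j) × ℝ)) with hgi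
    have hgl_L : ∀ w t, gl (L (w, t)) = t := fun w t => by simp [hgl]
    have hgi_L : ∀ w t, gi (L (w, t)) = w := fun w t => by simp [hgi]
    have hL_eq : ∀ x : EuclideanSpace ℝ (Fin (j + 1)), L (gi x, gl x) = x := fun x => by
      simp [hgl, hgi]
    set Gl : V → ℝ := gl ∘ G with hGl
    set Gi : V → EuclideanSpace ℝ (Fin j) := gi ∘ G with hGi
    have hGl_smooth : ContMDiff (𝓡 (m + j + 1)) 𝓘(ℝ, ℝ) ∞ Gl := gl.contDiff.comp_contMDiff hG
    have hGi_smooth : ContMDiff (𝓡 (m + j + 1)) (𝓡 j) ∞ Gi := gi.contDiff.comp_contMDiff hG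
    have hGdiff : ∀ v, MDifferentiableAt (𝓡 (m + j + 1)) (𝓡 (j + 1)) G v := fun v =>
      hG.mdifferentiableAt h0
    have hmf_Gl : ∀ v ξ, mfderiv (𝓡 (m + j + 1)) 𝓘(ℝ, ℝ) Gl v ξ =
        gl (mfderiv (𝓡 (m + j + 1)) (𝓡 (j + 1)) G v ξ) := by
      intro v ξ
      rw [hGl, mfderiv_comp v gl.mdifferentiableAt (hGdiff v), ContinuousLinearMap.mfderiv_eq]
      rfl
    have hmf_Gi : ∀ v ξ, mfderiv (𝓡 (m + j + 1)) (𝓡 j) Gi v ξ =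
        gi (mfderiv (𝓡 (m + j + 1)) (𝓡 (j + 1)) G v ξ) := by
      intro v ξ
      rw [hGi, mfderiv_comp v gi.mdifferentiableAt (hGdiff v), ContinuousLinearMap.mfderiv_eq]
      rfl
    -- the last coordinate has `gl y` as a regular level in the interior
    have hreg : IsRegularLevel (𝓡 (m + j + 1)) Gl (gl y) := by
      refine ⟨hGl_smooth, fun v _ => BoundarylessManifold.isInteriorPoint, fun v _ hcrit => ?_⟩
      obtain ⟨ξ, hξ⟩ := hsurj v (L (0, 1))
      have key : gl (mfderiv (𝓡 (m + j + 1)) (𝓡 (j + 1)) G v ξ) = 1 := by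
        rw [hξ, hgl_L]
      have key0 : gl (mfderiv (𝓡 (m + j + 1)) (𝓡 (j + 1)) G v ξ) = 0 := by
        have h := hmf_Gl v ξ
        rw [show mfderiv (𝓡 (m + j + 1)) 𝓘(ℝ, ℝ) Gl v = 0 from hcrit] at h
        exact h.symm
      exact one_ne_zero (key.symm.trans key0)
    -- the level `Z₁ = Gl⁻¹(gl y)` and its inclusion `ι`
    set ι : RegularLevel hreg → V := RegularLevel.incl hreg with hι
    have hιdiff : ∀ z, MDifferentiableAt (𝓡 (m + j)) (𝓡 (m + j + 1)) ι z := fun z =>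
      (RegularLevel.contMDiff_incl hreg).mdifferentiableAt h0
    have hιinj : ∀ z, Injective (mfderiv (𝓡 (m + j)) (𝓡 (m + j + 1)) ι z) := fun z =>
      injective_mfderiv_of_isImmersionAt' ((RegularLevel.isImmersion_incl hreg).isImmersionAt z)
    have hGlι : Gl ∘ ι = fun _ => gl y := funext fun z => RegularLevel.apply_incl hreg z
    -- `T Z₁ = ker dGl`
    have hker_iff : ∀ (z : RegularLevel hreg) (ξ : EuclideanSpace ℝ (Fin (m + j + 1))),
        mfderiv (𝓡 (m + j + 1)) 𝓘(ℝ, ℝ) Gl (ι z) ξ = 0 ↔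
          ∃ u : EuclideanSpace ℝ (Fin (m + j)), mfderiv (𝓡 (m + j)) (𝓡 (m + j + 1)) ι z u = ξ := by
      intro z ξ
      have hcomp0 : ∀ u, mfderiv (𝓡 (m + j + 1)) 𝓘(ℝ, ℝ) Gl (ι z)
          (mfderiv (𝓡 (m + j)) (𝓡 (m + j + 1)) ι z u) = 0 := by
        intro u
        have hc := mfderiv_comp z (hGl_smooth.mdifferentiableAt h0) (hιdiff z)
        rw [hGlι, mfderiv_const] at hc
        exact (DFunLike.congr_fun hc u).symm
      refine ⟨fun hξ => ?_, ?_⟩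
      · exact exists_apply_eq_of_linearForm_apply_eq_zero (hιinj z)
          (hreg.not_isMCriticalPt (RegularLevel.apply_incl hreg z)) hcomp0 hξ
      · rintro ⟨u, rfl⟩
        exact hcomp0 u
    -- the first coordinates restricted to the level, again with onto differential
    set G' : RegularLevel hreg → EuclideanSpace ℝ (Fin j) := Gi ∘ ι with hG'
    have hG'smooth : ContMDiff (𝓡 (m + j)) (𝓡 j) ∞ G' :=
      hGi_smooth.comp (RegularLevel.contMDiff_incl hreg)
    have hmf_G' : ∀ z u, mfderiv (𝓡 (m + j)) (𝓡 j) G' z u =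
        gi (mfderiv (𝓡 (m + j + 1)) (𝓡 (j + 1)) G (ι z)
          (mfderiv (𝓡 (m + j)) (𝓡 (m + j + 1)) ι z u)) := by
      intro z u
      rw [hG', mfderiv_comp z (hGi_smooth.mdifferentiableAt h0) (hιdiff z)]
      exact hmf_Gi (ι z) _
    have hsurj' : ∀ z, Surjective (mfderiv (𝓡 (m + j)) (𝓡 j) G' z) := by
      intro z w
      obtain ⟨ξ, hξ⟩ := hsurj (ι z) (L (w, 0))
      have hξ0 : gl (mfderiv (𝓡 (m + j + 1)) (𝓡 (j + 1)) G (ι z) ξ) = 0 := by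
        rw [hξ, hgl_L]
      obtain ⟨u, hu⟩ := (hker_iff z ξ).1 (by rw [hmf_Gl]; exact hξ0)
      refine ⟨u, ?_⟩
      rw [hmf_G', hu, hξ, hgi_L]
    -- induction hypothesis applied to the level
    obtain ⟨Z, _, _, _, _, _, e', he', hre', hte'⟩ :=
      ih m (m + j) rfl (RegularLevel hreg) G' hG'smooth hsurj' (gi y)
    have he'diff : ∀ z, MDifferentiableAt (𝓡 m) (𝓡 (m + j)) e' z := fun z =>
      he'.contMDiff.mdifferentiableAt h0
    -- the composite embedding lands in `G⁻¹(y)`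
    have hGιe' : ∀ w, G (ι (e' w)) = y := by
      intro w
      have hw1 : Gl (ι (e' w)) = gl y := RegularLevel.apply_incl hreg (e' w)
      have hw2 : G' (e' w) = gi y := by
        have : e' w ∈ range e' := mem_range_self w
        rw [hre'] at this
        exact this
      calc G (ι (e' w)) = L (gi (G (ι (e' w))), gl (G (ι (e' w)))) := (hL_eq _).symm
        _ = L (G' (e' w), Gl (ι (e' w))) := rfl
        _ = L (gi y, gl y) := by rw [hw2, hw1]
        _ = y := hL_eq y
    refine ⟨Z, inferInstance, inferInstance, inferInstance, inferInstance, inferInstance, ι ∘ e',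
      ?_, ?_, ?_⟩
    · -- `ι ∘ e'` is a smooth embedding
      have hcontMDiff : ContMDiff (𝓡 m) (𝓡 (m + j + 1)) ∞ (ι ∘ e') :=
        (RegularLevel.contMDiff_incl hreg).comp he'.contMDiff
      refine ⟨isImmersion_of_injective_mfderiv hcontMDiff h1 fun z => ?_,
        (RegularLevel.isEmbedding_incl hreg).comp he'.isEmbedding⟩
      rw [mfderiv_comp z (hιdiff (e' z)) (he'diff z)]
      exact (hιinj (e' z)).comp
        (injective_mfderiv_of_isImmersionAt' (he'.isImmersion.isImmersionAt z))
    · -- `range (ι ∘ e') = G⁻¹(y)`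
      ext p
      simp only [mem_range, comp_apply, mem_preimage, mem_singleton_iff]
      constructor
      · rintro ⟨w, rfl⟩
        exact hGιe' w
      · intro hp
        have hpl : Gl p = gl y := by simp [hGl, hp]
        have hz : (⟨p, hpl⟩ : RegularLevel hreg) ∈ range e' := by
          rw [hre']
          show Gi p = gi y
          simp [hGi, hp]
        obtain ⟨w, hw⟩ := hz
        exact ⟨w, by rw [hw]⟩
    · -- `range d(ι ∘ e') = ker dG`
      intro z ξ
      have hcompι : ∀ w, mfderiv (𝓡 m) (𝓡 (m + j + 1)) (ι ∘ e') z w =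
          mfderiv (𝓡 (m + j)) (𝓡 (m + j + 1)) ι (e' z)
            (mfderiv (𝓡 m) (𝓡 (m + j)) e' z w) := by
        intro w
        rw [mfderiv_comp z (hιdiff (e' z)) (he'diff z)]
        rfl
      constructor
      · intro hξ
        have hξ' : mfderiv (𝓡 (m + j + 1)) (𝓡 (j + 1)) G (ι (e' z)) ξ = 0 := hξ
        have hl : mfderiv (𝓡 (m + j + 1)) 𝓘(ℝ, ℝ) Gl (ι (e' z)) ξ = 0 := by
          rw [hmf_Gl, hξ']
          exact map_zero gl
        obtain ⟨u, hu⟩ := (hker_iff (e' z) ξ).1 hl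
        have h2 : mfderiv (𝓡 (m + j)) (𝓡 j) G' (e' z) u = 0 := by
          rw [hmf_G', hu, hξ']
          exact map_zero gi
        obtain ⟨w, hw⟩ := (hte' z u).1 h2
        exact ⟨w, by rw [hcompι, hw, hu]⟩
      · rintro ⟨w, rfl⟩
        have hconst : G ∘ (ι ∘ e') = fun _ => y := funext fun w => hGιe' w
        have hc := mfderiv_comp z (hGdiff _) ((hιdiff (e' z)).comp z (he'diff z))
        rw [hconst, mfderiv_const] at hc
        exact (DFunLike.congr_fun hc w).symm

/-- **The regular value theorem for `G : ℝᴺ ⊇ U → ℝᵏ`** (Hirsch, *Differential Topology* (1976),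
Ch. 1 §3, Thm. 3.2; the transversality step of the Pontryagin–Thom construction, Kervaire–Milnor
1963, proof of Lemma 4.2).  Let `G : ℝᴺ → ℝᵏ` be `C^∞` on an open set `U`, `N = m + k`, and let
`y` be a regular value of `G|U` — `dG_p` is onto for every `p ∈ U` with `G p = y`.  Then there are
a `C^∞` `m`-manifold `Z` without boundary (Hausdorff, second countable) and a `C^∞` embedding
`e : Z → ℝᴺ` with `range e = U ∩ G⁻¹(y)` whose differential has range `ker dG` at every point:
`fderiv ℝ G (e z) ξ = 0 ↔ ξ ∈ range (de_z)`.  (Apply `exists_regularPreimage` on the open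
submanifold of regular points of `U`, `isOpen_inter_setOf_surjective`.)
[cite: HirschDT1976, Ch. 1 §3 Thm. 3.2 and §4 Thm. 4.1] -/
theorem exists_regularPreimage_of_contDiffOn {N k m : ℕ} (hN : N = m + k)
    {G : EuclideanSpace ℝ (Fin N) → EuclideanSpace ℝ (Fin k)} {U : Set (EuclideanSpace ℝ (Fin N))}
    (hU : IsOpen U) (hG : ContDiffOn ℝ ∞ G U) (y : EuclideanSpace ℝ (Fin k))
    (hy : ∀ p ∈ U, G p = y → Surjective (fderiv ℝ G p)) :
    ∃ (Z : Type) (_ : TopologicalSpace Z) (_ : T2Space Z) (_ : SecondCountableTopology Z)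
      (_ : ChartedSpace (EuclideanSpace ℝ (Fin m)) Z) (_ : IsManifold (𝓡 m) ∞ Z)
      (e : Z → EuclideanSpace ℝ (Fin N)),
      Manifold.IsSmoothEmbedding (𝓡 m) (𝓡 N) ∞ e ∧ range e = U ∩ G ⁻¹' {y} ∧
      ∀ (z : Z) (ξ : EuclideanSpace ℝ (Fin N)), fderiv ℝ G (e z) ξ = 0 ↔
        ∃ u : EuclideanSpace ℝ (Fin m), mfderiv (𝓡 m) (𝓡 N) e z u = ξ := by
  have h1 : (1 : ℕ∞ω) ≤ ∞ := by exact_mod_cast le_top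
  have h0 : (∞ : ℕ∞ω) ≠ 0 := by simp
  -- the open submanifold of regular points of `U`
  set U' : Set (EuclideanSpace ℝ (Fin N)) := {p ∈ U | Surjective (fderiv ℝ G p)} with hU'
  have hU'open : IsOpen U' :=
    isOpen_inter_setOf_surjective hU (hG.continuousOn_fderiv_of_isOpen hU h1)
  set O : TopologicalSpace.Opens (EuclideanSpace ℝ (Fin N)) := ⟨U', hU'open⟩ with hO
  have hGdiff : ∀ v : O, DifferentiableAt ℝ G (v : EuclideanSpace ℝ (Fin N)) := fun v =>
    (hG.differentiableOn h0).differentiableAt (hU.mem_nhds v.2.1)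
  have hGO : ContMDiff (𝓡 N) (𝓡 k) ∞ (G ∘ (Subtype.val : O → EuclideanSpace ℝ (Fin N))) := by
    have hG' : ContMDiffOn (𝓡 N) (𝓡 k) ∞ G U' := (hG.mono fun p hp => hp.1).contMDiffOn
    exact hG'.comp_contMDiff contMDiff_subtype_val fun p => p.2
  have hmfO : ∀ (v : O) (ξ : EuclideanSpace ℝ (Fin N)),
      mfderiv (𝓡 N) (𝓡 k) (G ∘ (Subtype.val : O → EuclideanSpace ℝ (Fin N))) v ξ =
        fderiv ℝ G (v : EuclideanSpace ℝ (Fin N)) ξ := by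
    intro v ξ
    rw [mfderiv_comp v (hGdiff v).mdifferentiableAt
        (Literature.Geometry.Manifold.OpenSubmanifold.mdifferentiableAt_subtype_val v),
      Literature.Geometry.Manifold.OpenSubmanifold.mfderiv_subtype_val, mfderiv_eq_fderiv]
    rfl
  have hsurjO : ∀ v : O,
      Surjective (mfderiv (𝓡 N) (𝓡 k) (G ∘ (Subtype.val : O → EuclideanSpace ℝ (Fin N))) v) :=
      fun v w => by
    obtain ⟨ξ, hξ⟩ := v.2.2 w
    exact ⟨ξ, by rw [hmfO]; exact hξ⟩
  obtain ⟨Z, _, _, _, _, _, e, he, hre, hte⟩ :=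
    exists_regularPreimage k m N hN O (G ∘ Subtype.val) hGO hsurjO y
  have hediff : ∀ z, MDifferentiableAt (𝓡 m) (𝓡 N) e z := fun z =>
    he.contMDiff.mdifferentiableAt h0
  have hval_diff :
      ∀ v : O, MDifferentiableAt (𝓡 N) (𝓡 N) (Subtype.val : O → EuclideanSpace ℝ (Fin N)) v :=
    Literature.Geometry.Manifold.OpenSubmanifold.mdifferentiableAt_subtype_val
  have hmf_comp : ∀ z u,
      mfderiv (𝓡 m) (𝓡 N) ((Subtype.val : O → EuclideanSpace ℝ (Fin N)) ∘ e) z u =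
      mfderiv (𝓡 m) (𝓡 N) e z u := by
    intro z u
    rw [mfderiv_comp z (hval_diff (e z)) (hediff z),
      Literature.Geometry.Manifold.OpenSubmanifold.mfderiv_subtype_val]
    rfl
  refine ⟨Z, inferInstance, inferInstance, inferInstance, inferInstance, inferInstance,
    Subtype.val ∘ e, ?_, ?_, fun z ξ => ?_⟩
  · -- smooth embedding into `ℝᴺ`
    have hcont : ContMDiff (𝓡 m) (𝓡 N) ∞ ((Subtype.val : O → EuclideanSpace ℝ (Fin N)) ∘ e) :=
      contMDiff_subtype_val.comp he.contMDiff
    refine ⟨isImmersion_of_injective_mfderiv hcont h1 fun z a b hab => ?_,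
      Topology.IsEmbedding.subtypeVal.comp he.isEmbedding⟩
    rw [hmf_comp, hmf_comp] at hab
    exact injective_mfderiv_of_isImmersionAt' (he.isImmersion.isImmersionAt z) hab
  · -- range
    rw [range_comp, hre]
    ext p
    simp only [mem_image, mem_preimage, comp_apply, mem_singleton_iff, mem_inter_iff]
    constructor
    · rintro ⟨v, hv, rfl⟩
      exact ⟨v.2.1, hv⟩
    · rintro ⟨hpU, hp⟩
      exact ⟨⟨p, hpU, hy p hpU hp⟩, hp, rfl⟩
  · -- tangent space
    constructor
    · intro h
      obtain ⟨u, hu⟩ := (hte z ξ).1 (by rw [hmfO]; exact h)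
      exact ⟨u, by rw [hmf_comp]; exact hu⟩
    · rintro ⟨u, hu⟩
      have h' := (hte z ξ).2 ⟨u, by rw [← hmf_comp]; exact hu⟩
      rw [hmfO] at h'
      exact h'

end Main

end Literature.Topology.FourManifolds

end
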